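import Mathlib
import Literature.Probability.LatticeModels.LebowitzInequality
import HarnessLib

/-!
# Crux `PrecisionLaplacian.InverseMFerromagnet` (stmt-CriticalPhenomena-4798), line `Sketch` —
# stub `stub_pcm_of_nc` (core chain, "NC ⇒ PCM")

THEOREM-ONLY file (no definitions).  A *system* is a family of nonnegative couplings
`K : Fin m → ℝ` on supports `C i ⊆ Fin n` of at most two sites (pairs, fields, constants), with
expectation `⟨·⟩ = gksExpect univ K C`, magnetisations `m_w = ⟨σ_w⟩` and covariances
`Cov(w,z) = ⟨σ_wσ_z⟩ − ⟨σ_w⟩⟨σ_z⟩`.  Extra fields `h : Fin n → ℝ` are added by enlarging the index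
type to `Fin m ⊕ Fin n` (couplings `Sum.elim K h`, supports `Sum.elim C ({·})`).

* **NC** (nested cones, the hypothesis): for `0 ≤ h' ≤ h` and every `c`,
  `(∀ z, 0 ≤ ∑_w c_w Cov_h(w,z)) → (∀ z, 0 ≤ ∑_w c_w Cov_{h'}(w,z))`.
* **PCM** (the conclusion): `(∀ z, 0 ≤ ∑_w c_w Cov(w,z)) → 0 ≤ ∑_w c_w m_w`.

Proof of NC ⇒ PCM.  Regroup the system as "even part `K₀` (pairs and constants) + one field
`h_z = ∑_{C i = {z}} K_i` per site": the Hamiltonians coincide, so all expectations do.  Put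
`F(t) = ∑_w c_w ⟨σ_w⟩_{t h}` (fields scaled by `t`).  Then `F(0) = 0` by the global spin flip
(every nonzero coupling sits on an even support), `F'(t) = ∑_z h_z ∑_w c_w Cov_{t h}(w,z)`
(derivative in the field couplings), and for `t ∈ [0,1]` the right-hand side is `≥ 0` by NC applied
to the fields `t h ≤ h` (the premise at `h` is the PCM premise, transported through the
regrouping).  Hence `F(1) ≥ F(0) = 0`, and `F(1) = ∑_w c_w m_w`.

The derivative-in-the-couplings calculus follows `hasDerivAt_gksSum_cplAt` of `LebowitzInequality`,
specialised to the field ray.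
-/

namespace Summit.CriticalPhenomena.Ising3DConformalLimit.Cruxes.InverseMFerromagnet.PartialCovarianceLadder

open Literature.Probability.LatticeModels Finset Matrix

/-! ## Linearity of `⟨·⟩` over weighted finite sums -/

/-- `⟨∑_z a_z G_z⟩ = ∑_z a_z ⟨G_z⟩`. [folklore] -/
theorem pcmOfNc_gksExpect_sum_smul {Λ ι α : Type*} [Fintype Λ] [DecidableEq Λ] (s : Finset ι)
    (K : ι → ℝ) (C : ι → Finset Λ) (T : Finset α) (a : α → ℝ) (G : α → SpinConfig Λ → ℝ) :
    gksExpect s K C (fun ω => ∑ z ∈ T, a z * G z ω) = ∑ z ∈ T, a z * gksExpect s K C (G z) := by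
  unfold gksExpect gksSum
  simp_rw [mul_div_assoc', ← Finset.sum_div, Finset.mul_sum, Finset.sum_mul]
  rw [Finset.sum_comm]
  exact congrArg₂ (· / ·) (Finset.sum_congr rfl fun z _ => Finset.sum_congr rfl fun ω _ => by ring) rfl

/-! ## The global spin flip at zero field -/

/-- Zero-field spin-flip symmetry: if every interaction term with nonzero coupling has an even number
of sites, then `Z⟨σ_w⟩ = 0` (the weight is invariant and `σ_w` is odd under the global flip).
[folklore] -/
theorem pcmOfNc_gksSum_spinAt_eq_zero_of_even {Λ ι : Type*} [Fintype Λ] [DecidableEq Λ]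
    (s : Finset ι) (K : ι → ℝ) (C : ι → Finset Λ)
    (heven : ∀ i ∈ s, K i = 0 ∨ Even (C i).card) (w : Λ) :
    gksSum s K C (spinAt w) = 0 := by
  have hw : ∀ σ, gksWeight s K C (flipOn Finset.univ σ) = gksWeight s K C σ := by
    intro σ
    simp only [gksWeight, gksHamiltonian]
    congr 1
    refine Finset.sum_congr rfl fun i hi => ?_
    rw [spinProduct_flipOn, Finset.inter_univ]
    rcases heven i hi with h0 | hev
    · simp [h0]
    · rw [hev.neg_one_pow, one_mul]
  have hodd : ∀ σ, spinAt w (flipOn Finset.univ σ) = -spinAt w σ := by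
    intro σ
    simp only [spinAt_flipOn, Finset.mem_univ, if_true]
  unfold gksSum
  have h : ∑ σ, spinAt w σ * gksWeight s K C σ =
      ∑ σ, spinAt w (flipOn Finset.univ σ) * gksWeight s K C (flipOn Finset.univ σ) :=
    (Fintype.sum_bijective _ (flipOn_involutive Finset.univ).bijective _ _ fun _ => rfl).symm
  have h2 : ∑ σ, spinAt w (flipOn Finset.univ σ) * gksWeight s K C (flipOn Finset.univ σ) =
      -∑ σ, spinAt w σ * gksWeight s K C σ := by
    rw [← Finset.sum_neg_distrib]
    exact Finset.sum_congr rfl fun σ _ => by rw [hodd, hw]; ring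
  linarith

/-! ## Base system plus fields: the Hamiltonian, regrouping, and the derivative in the fields -/

/-- The Hamiltonian of "base system `K₀` + fields `g`" on the index type `Fin m ⊕ Fin n` splits as
`H_{K₀} + ∑_z g_z σ_z`. [folklore] -/
theorem pcmOfNc_hamiltonian_fields (n m : ℕ) (K₀ : Fin m → ℝ) (C : Fin m → Finset (Fin n))
    (g : Fin n → ℝ) (ω : SpinConfig (Fin n)) :
    gksHamiltonian (Finset.univ : Finset (Fin m ⊕ Fin n)) (Sum.elim K₀ g)
        (Sum.elim C (fun z => ({z} : Finset (Fin n)))) ω =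
      gksHamiltonian Finset.univ K₀ C ω + ∑ z, g z * spinAt z ω := by
  simp only [gksHamiltonian, Fintype.sum_sum_type, Sum.elim_inl, Sum.elim_inr, spinProduct,
    Finset.prod_singleton]

/-- **Regrouping.** A system with supports of at most two sites has the same Hamiltonian as the
system "even part `K₀ᵢ = Kᵢ·1[|Cᵢ| ≠ 1]` + one field `h_z = ∑_{Cᵢ = {z}} Kᵢ` per site". [folklore] -/
theorem pcmOfNc_hamiltonian_regroup (n m : ℕ) (K : Fin m → ℝ) (C : Fin m → Finset (Fin n))
    (ω : SpinConfig (Fin n)) :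
    gksHamiltonian Finset.univ K C ω =
      gksHamiltonian (Finset.univ : Finset (Fin m ⊕ Fin n))
        (Sum.elim (fun i => if (C i).card = 1 then 0 else K i)
          (fun z => ∑ i, if C i = {z} then K i else 0))
        (Sum.elim C (fun z => ({z} : Finset (Fin n)))) ω := by
  rw [pcmOfNc_hamiltonian_fields]
  simp only [gksHamiltonian]
  have key : ∀ i : Fin m, K i * spinProduct (C i) ω =
      (if (C i).card = 1 then 0 else K i) * spinProduct (C i) ω +
        ∑ z, (if C i = {z} then K i else 0) * spinAt z ω := by
    intro i
    by_cases hi : (C i).card = 1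
    · obtain ⟨z₀, hz₀⟩ := Finset.card_eq_one.1 hi
      rw [if_pos hi, hz₀]
      have h1 : ∀ z : Fin n, (if ({z₀} : Finset (Fin n)) = {z} then K i else 0) * spinAt z ω =
          if z₀ = z then K i * spinAt z ω else 0 := by
        intro z
        simp only [Finset.singleton_inj]
        split_ifs <;> ring
      simp only [h1, Finset.sum_ite_eq, Finset.mem_univ, if_true, spinProduct,
        Finset.prod_singleton]
      ring
    · rw [if_neg hi]
      have h1 : ∀ z : Fin n, (if C i = {z} then K i else 0) * spinAt z ω = 0 := by
        intro z
        rw [if_neg, zero_mul]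
        intro h
        exact hi (h ▸ Finset.card_singleton z)
      simp only [h1, Finset.sum_const_zero, add_zero]
  rw [Finset.sum_congr rfl fun i _ => key i, Finset.sum_add_distrib]
  congr 1
  rw [Finset.sum_comm]
  refine Finset.sum_congr rfl fun z _ => ?_
  rw [Finset.sum_mul]

/-- Regrouping does not change expectations. [folklore] -/
theorem pcmOfNc_gksExpect_regroup (n m : ℕ) (K : Fin m → ℝ) (C : Fin m → Finset (Fin n))
    (f : SpinConfig (Fin n) → ℝ) :
    gksExpect Finset.univ K C f =
      gksExpect (Finset.univ : Finset (Fin m ⊕ Fin n))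
        (Sum.elim (fun i => if (C i).card = 1 then 0 else K i)
          (fun z => ∑ i, if C i = {z} then K i else 0))
        (Sum.elim C (fun z => ({z} : Finset (Fin n)))) f := by
  simp only [gksExpect, gksSum, gksWeight, pcmOfNc_hamiltonian_regroup]

/-- `d/dt (Z_t⟨F⟩_t) = Z_t⟨F · ∑_z g_zσ_z⟩_t` along the field ray `t ↦ t g` (elementary calculus on a
finite sum of exponentials). [folklore] -/
theorem pcmOfNc_hasDerivAt_gksSum (n m : ℕ) (K₀ : Fin m → ℝ) (C : Fin m → Finset (Fin n))
    (g : Fin n → ℝ) (F : SpinConfig (Fin n) → ℝ) (t : ℝ) :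
    HasDerivAt (fun t => gksSum (Finset.univ : Finset (Fin m ⊕ Fin n))
        (Sum.elim K₀ (fun z => t * g z)) (Sum.elim C (fun z => ({z} : Finset (Fin n)))) F)
      (gksSum (Finset.univ : Finset (Fin m ⊕ Fin n)) (Sum.elim K₀ (fun z => t * g z))
        (Sum.elim C (fun z => ({z} : Finset (Fin n)))) (fun ω => F ω * ∑ z, g z * spinAt z ω)) t := by
  have hH : ∀ (t : ℝ) (ω : SpinConfig (Fin n)),
      gksHamiltonian (Finset.univ : Finset (Fin m ⊕ Fin n)) (Sum.elim K₀ (fun z => t * g z))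
        (Sum.elim C (fun z => ({z} : Finset (Fin n)))) ω =
      gksHamiltonian Finset.univ K₀ C ω + t * ∑ z, g z * spinAt z ω := by
    intro t ω
    rw [pcmOfNc_hamiltonian_fields, Finset.mul_sum]
    simp only [mul_assoc]
  have hfun : (fun t => gksSum (Finset.univ : Finset (Fin m ⊕ Fin n))
      (Sum.elim K₀ (fun z => t * g z)) (Sum.elim C (fun z => ({z} : Finset (Fin n)))) F) =
      fun t => ∑ ω, F ω * Real.exp (gksHamiltonian Finset.univ K₀ C ω +
        t * ∑ z, g z * spinAt z ω) := by
    funext t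
    simp only [gksSum, gksWeight, hH]
  have hval : gksSum (Finset.univ : Finset (Fin m ⊕ Fin n)) (Sum.elim K₀ (fun z => t * g z))
      (Sum.elim C (fun z => ({z} : Finset (Fin n)))) (fun ω => F ω * ∑ z, g z * spinAt z ω) =
      ∑ ω, F ω * (Real.exp (gksHamiltonian Finset.univ K₀ C ω + t * ∑ z, g z * spinAt z ω) *
        ∑ z, g z * spinAt z ω) := by
    simp only [gksSum, gksWeight, hH]
    exact Finset.sum_congr rfl fun ω _ => by ring
  rw [hfun, hval]
  refine HasDerivAt.fun_sum fun ω _ => ?_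
  have h1 : HasDerivAt (fun t : ℝ => gksHamiltonian Finset.univ K₀ C ω +
      t * ∑ z, g z * spinAt z ω) (∑ z, g z * spinAt z ω) t := by
    simpa using (hasDerivAt_mul_const (x := t) (∑ z, g z * spinAt z ω)).const_add
      (gksHamiltonian Finset.univ K₀ C ω)
  exact h1.exp.const_mul (F ω)

/-- The derivative of `⟨F⟩_t` along the field ray, in covariance form:
`d/dt ⟨F⟩_{t g} = ⟨F S⟩_{t g} − ⟨F⟩_{t g}⟨S⟩_{t g}` with `S = ∑_z g_zσ_z`. [folklore] -/
theorem pcmOfNc_hasDerivAt_gksExpect (n m : ℕ) (K₀ : Fin m → ℝ) (C : Fin m → Finset (Fin n))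
    (g : Fin n → ℝ) (F : SpinConfig (Fin n) → ℝ) (t : ℝ) :
    HasDerivAt (fun t => gksExpect (Finset.univ : Finset (Fin m ⊕ Fin n))
        (Sum.elim K₀ (fun z => t * g z)) (Sum.elim C (fun z => ({z} : Finset (Fin n)))) F)
      (gksExpect (Finset.univ : Finset (Fin m ⊕ Fin n)) (Sum.elim K₀ (fun z => t * g z))
          (Sum.elim C (fun z => ({z} : Finset (Fin n)))) (fun ω => F ω * ∑ z, g z * spinAt z ω) -
        gksExpect (Finset.univ : Finset (Fin m ⊕ Fin n)) (Sum.elim K₀ (fun z => t * g z))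
          (Sum.elim C (fun z => ({z} : Finset (Fin n)))) F *
        gksExpect (Finset.univ : Finset (Fin m ⊕ Fin n)) (Sum.elim K₀ (fun z => t * g z))
          (Sum.elim C (fun z => ({z} : Finset (Fin n)))) (fun ω => ∑ z, g z * spinAt z ω)) t := by
  have hZ := gksSum_one_pos (Finset.univ : Finset (Fin m ⊕ Fin n)) (Sum.elim K₀ (fun z => t * g z))
    (Sum.elim C (fun z => ({z} : Finset (Fin n))))
  have h := (pcmOfNc_hasDerivAt_gksSum n m K₀ C g F t).div
    (pcmOfNc_hasDerivAt_gksSum n m K₀ C g (fun _ => 1) t) hZ.ne'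
  refine h.congr_deriv ?_
  simp only [gksExpect, one_mul]
  field_simp

/-! ## NC ⇒ PCM -/

/-- **NC ⇒ PCM.** If, for every system with nonnegative couplings on supports of at most two sites,
the cone `{c : ∀ z, ∑_w c_w Cov_h(w,z) ≥ 0}` at the larger nonnegative field `h` is contained in the
cone at every smaller field `0 ≤ h' ≤ h` (NC), then for every such system
`(∀ z, ∑_w c_w Cov(w,z) ≥ 0) ⟹ ∑_w c_w ⟨σ_w⟩ ≥ 0` (PCM).  Proof: regroup the system as even part
plus one field per site, scale the fields by `t ∈ [0,1]`, and integrate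
`d/dt ∑_w c_w⟨σ_w⟩_t = ∑_z h_z ∑_w c_w Cov_t(w,z) ≥ 0` from the symmetric point `t = 0`, where every
magnetisation vanishes. [folklore] -/
theorem stub_pcm_of_nc : (∀ (n m : ℕ) (K : Fin m → ℝ) (C : Fin m → Finset (Fin n)), (∀ i, 0 ≤ K i) → (∀ i, (C i).card ≤ 2) → ∀ (h h' : Fin n → ℝ), (∀ z, 0 ≤ h' z) → (∀ z, h' z ≤ h z) → ∀ c : Fin n → ℝ, (∀ z : Fin n, 0 ≤ ∑ w, c w * (gksExpect (Finset.univ : Finset (Fin m ⊕ Fin n)) (Sum.elim K h) (Sum.elim C (fun z => ({z} : Finset (Fin n)))) (fun ω => spinAt w ω * spinAt z ω) - gksExpect (Finset.univ : Finset (Fin m ⊕ Fin n)) (Sum.elim K h) (Sum.elim C (fun z => ({z} : Finset (Fin n)))) (spinAt w) * gksExpect (Finset.univ : Finset (Fin m ⊕ Fin n)) (Sum.elim K h) (Sum.elim C (fun z => ({z} : Finset (Fin n)))) (spinAt z))) → (∀ z : Fin n, 0 ≤ ∑ w, c w * (gksExpect (Finset.univ : Finset (Fin m ⊕ Fin n))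 (Sum.elim K h') (Sum.elim C (fun z => ({z} : Finset (Fin n)))) (fun ω => spinAt w ω * spinAt z ω) - gksExpect (Finset.univ : Finset (Fin m ⊕ Fin n)) (Sum.elim K h') (Sum.elim C (fun z => ({z} : Finset (Fin n)))) (spinAt w) * gksExpect (Finset.univ : Finset (Fin m ⊕ Fin n)) (Sum.elim K h') (Sum.elim C (fun z => ({z} : Finset (Fin n)))) (spinAt z)))) → (∀ (n m : ℕ) (K : Fin m → ℝ) (C : Fin m → Finset (Fin n)), (∀ i, 0 ≤ K i) → (∀ i, (C i).card ≤ 2) → ∀ c : Fin n → ℝ, (∀ z : Fin n, 0 ≤ ∑ w, c w * (gksExpect Finset.univ K C (fun ω => spinAt w ω * spinAt z ω) - gksExpect Finset.univ K C (spinAt w) * gksExpect Finset.univ K C (spinAt z))) → 0 ≤ ∑ w, c w * gksExpect Finset.univ K C (spinAt w)) := by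
  intro hNC n m K C hK hC c hc
  -- Step 1: regroup the system as "even part `K₀` + one field `hf z` per site".
  set K₀ : Fin m → ℝ := fun i => if (C i).card = 1 then 0 else K i with hK₀def
  set hf : Fin n → ℝ := fun z => ∑ i, if C i = {z} then K i else 0 with hhfdef
  have hK₀ : ∀ i, 0 ≤ K₀ i := by
    intro i
    simp only [hK₀def]
    split_ifs
    exacts [le_rfl, hK i]
  have hhf : ∀ z, 0 ≤ hf z := by
    intro z
    simp only [hhfdef]
    exact Finset.sum_nonneg fun i _ => by split_ifs; exacts [hK i, le_rfl]
  have hregroup : ∀ f, gksExpect Finset.univ K C f =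
      gksExpect (Finset.univ : Finset (Fin m ⊕ Fin n)) (Sum.elim K₀ hf)
        (Sum.elim C (fun z => ({z} : Finset (Fin n)))) f :=
    fun f => pcmOfNc_gksExpect_regroup n m K C f
  -- Step 2: the function `Φ(t) = ∑_w c_w ⟨σ_w⟩_{t·hf}` and its derivative `D(t)`.
  set Φ : ℝ → ℝ := fun t => ∑ w, c w *
      gksExpect (Finset.univ : Finset (Fin m ⊕ Fin n)) (Sum.elim K₀ (fun z => t * hf z))
        (Sum.elim C (fun z => ({z} : Finset (Fin n)))) (spinAt w) with hΦ
  set D : ℝ → ℝ := fun t => ∑ z, hf z * ∑ w, c w *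
      (gksExpect (Finset.univ : Finset (Fin m ⊕ Fin n)) (Sum.elim K₀ (fun z => t * hf z))
          (Sum.elim C (fun z => ({z} : Finset (Fin n)))) (fun ω => spinAt w ω * spinAt z ω) -
        gksExpect (Finset.univ : Finset (Fin m ⊕ Fin n)) (Sum.elim K₀ (fun z => t * hf z))
          (Sum.elim C (fun z => ({z} : Finset (Fin n)))) (spinAt w) *
        gksExpect (Finset.univ : Finset (Fin m ⊕ Fin n)) (Sum.elim K₀ (fun z => t * hf z))
          (Sum.elim C (fun z => ({z} : Finset (Fin n)))) (spinAt z)) with hD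
  have hder : ∀ t, HasDerivAt Φ (D t) t := by
    intro t
    have h1 : HasDerivAt Φ (∑ w, c w *
        (gksExpect (Finset.univ : Finset (Fin m ⊕ Fin n)) (Sum.elim K₀ (fun z => t * hf z))
            (Sum.elim C (fun z => ({z} : Finset (Fin n))))
            (fun ω => spinAt w ω * ∑ z, hf z * spinAt z ω) -
          gksExpect (Finset.univ : Finset (Fin m ⊕ Fin n)) (Sum.elim K₀ (fun z => t * hf z))
            (Sum.elim C (fun z => ({z} : Finset (Fin n)))) (spinAt w) *
          gksExpect (Finset.univ : Finset (Fin m ⊕ Fin n)) (Sum.elim K₀ (fun z => t * hf z))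
            (Sum.elim C (fun z => ({z} : Finset (Fin n)))) (fun ω => ∑ z, hf z * spinAt z ω))) t := by
      rw [hΦ]
      exact HasDerivAt.fun_sum fun w _ =>
        (pcmOfNc_hasDerivAt_gksExpect n m K₀ C hf (spinAt w) t).const_mul (c w)
    refine h1.congr_deriv ?_
    have e1 : ∀ w : Fin n,
        gksExpect (Finset.univ : Finset (Fin m ⊕ Fin n)) (Sum.elim K₀ (fun z => t * hf z))
            (Sum.elim C (fun z => ({z} : Finset (Fin n))))
            (fun ω => spinAt w ω * ∑ z, hf z * spinAt z ω) =
          ∑ z, hf z * gksExpect (Finset.univ : Finset (Fin m ⊕ Fin n))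
            (Sum.elim K₀ (fun z => t * hf z)) (Sum.elim C (fun z => ({z} : Finset (Fin n))))
            (fun ω => spinAt w ω * spinAt z ω) := by
      intro w
      have hφ : (fun ω => spinAt w ω * ∑ z, hf z * spinAt z ω) =
          fun ω => ∑ z, hf z * (spinAt w ω * spinAt z ω) := by
        funext ω
        rw [Finset.mul_sum]
        exact Finset.sum_congr rfl fun z _ => by ring
      rw [hφ]
      exact pcmOfNc_gksExpect_sum_smul _ _ _ _ _ _
    have e2 : gksExpect (Finset.univ : Finset (Fin m ⊕ Fin n)) (Sum.elim K₀ (fun z => t * hf z))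
          (Sum.elim C (fun z => ({z} : Finset (Fin n)))) (fun ω => ∑ z, hf z * spinAt z ω) =
        ∑ z, hf z * gksExpect (Finset.univ : Finset (Fin m ⊕ Fin n))
          (Sum.elim K₀ (fun z => t * hf z)) (Sum.elim C (fun z => ({z} : Finset (Fin n))))
          (spinAt z) := by
      exact pcmOfNc_gksExpect_sum_smul _ _ _ _ _ _
    simp only [e1, e2]
    simp only [hD, Finset.mul_sum, ← Finset.sum_sub_distrib]
    rw [Finset.sum_comm]
    exact Finset.sum_congr rfl fun z _ => Finset.sum_congr rfl fun w _ => by ring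
  -- Step 3: `D(t) ≥ 0` for `t ∈ [0,1]`, by NC applied to the fields `t·hf ≤ hf`.
  have hnonneg : ∀ t : ℝ, 0 ≤ t → t ≤ 1 → 0 ≤ D t := by
    intro t ht0 ht1
    have hprem : ∀ z : Fin n, 0 ≤ ∑ w, c w *
        (gksExpect (Finset.univ : Finset (Fin m ⊕ Fin n)) (Sum.elim K₀ hf)
            (Sum.elim C (fun z => ({z} : Finset (Fin n)))) (fun ω => spinAt w ω * spinAt z ω) -
          gksExpect (Finset.univ : Finset (Fin m ⊕ Fin n)) (Sum.elim K₀ hf)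
            (Sum.elim C (fun z => ({z} : Finset (Fin n)))) (spinAt w) *
          gksExpect (Finset.univ : Finset (Fin m ⊕ Fin n)) (Sum.elim K₀ hf)
            (Sum.elim C (fun z => ({z} : Finset (Fin n)))) (spinAt z)) := by
      intro z
      have hz := hc z
      simp only [hregroup] at hz
      exact hz
    have hnc := hNC n m K₀ C hK₀ hC hf (fun z => t * hf z) (fun z => mul_nonneg ht0 (hhf z))
      (fun z => mul_le_of_le_one_left (hhf z) ht1) c hprem
    simp only [hD]
    exact Finset.sum_nonneg fun z _ => mul_nonneg (hhf z) (hnc z)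
  -- Step 4: integrate.
  have hdiff : Differentiable ℝ Φ := fun t => (hder t).differentiableAt
  have hmono : MonotoneOn Φ (Set.Icc (0 : ℝ) 1) :=
    monotoneOn_of_deriv_nonneg (convex_Icc 0 1) hdiff.continuous.continuousOn
      hdiff.differentiableOn fun t ht => by
        rw [interior_Icc] at ht
        rw [(hder t).deriv]
        exact hnonneg t ht.1.le ht.2.le
  have h01 : Φ 0 ≤ Φ 1 :=
    hmono (Set.left_mem_Icc.2 zero_le_one) (Set.right_mem_Icc.2 zero_le_one) zero_le_one
  -- `Φ 0 = 0` by the global spin flip.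
  have hE0 : ∀ w : Fin n, gksExpect (Finset.univ : Finset (Fin m ⊕ Fin n))
      (Sum.elim K₀ (fun z => (0 : ℝ) * hf z)) (Sum.elim C (fun z => ({z} : Finset (Fin n))))
      (spinAt w) = 0 := by
    intro w
    unfold gksExpect
    rw [pcmOfNc_gksSum_spinAt_eq_zero_of_even _ _ _ ?_ w, zero_div]
    rintro (i | z) -
    · simp only [Sum.elim_inl]
      by_cases hi : (C i).card = 1
      · left
        simp only [hK₀def, hi, ↓reduceIte]
      · right
        have h02 : (C i).card = 0 ∨ (C i).card = 2 := by have := hC i; omega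
        rcases h02 with h | h
        · rw [h]; exact Even.zero
        · rw [h]; exact even_two
    · left
      simp only [Sum.elim_inr, zero_mul]
  have h0 : Φ 0 = 0 := by
    simp only [hΦ, hE0, mul_zero, Finset.sum_const_zero]
  -- `Φ 1` is the target, through the regrouping.
  have h1 : Φ 1 = ∑ w, c w * gksExpect Finset.univ K C (spinAt w) := by
    simp only [hΦ, one_mul, hregroup]
  rw [← h1]
  linarith

end Summit.CriticalPhenomena.Ising3DConformalLimit.Cruxes.InverseMFerromagnet.PartialCovarianceLadder
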